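import Literature.Topology.Immersions.ProjBundleOrientation
import HarnessLib

/-!
# Two orientations of a bundle over a connected base agree or are opposite

Topic `Literature/Topology/Immersions`. For a projection-field bundle `E = E(P)`
(`ProjectionFieldBundle.lean`) with two orientations `o₁, o₂` (`ProjBundle.IsOrientation`,
`ProjBundleOrientation.lean`) over a preconnected base, either `o₁ = o₂` or `o₁ = -o₂`
(Milnor–Stasheff, *Characteristic Classes* (1974), §9 p. 96 ff.: the set where two orientations
agree is open and closed). This is the dichotomy by which an isomorphism of oriented plane
bundles over a connected manifold either preserves or reverses the orientations, so that Euler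
classes agree up to sign.

* `ProjBundle.IsOrientation.isOpen_setOf_eq` — `{x | o₁ x = o₂ x}` is open;
* `ProjBundle.IsOrientation.eq_or_eq_neg` — the dichotomy over a preconnected base.

Everything here is proved; no definitions, no named facts.

## References

* J. Milnor, J. Stasheff, *Characteristic Classes* (1974), §9 p. 96. [MilnorStasheff1974]
-/

open scoped Manifold ContDiff Topology
open Set Function Module Filter

noncomputable section

namespace Literature.Topology.Immersions

/-- Local notation: `𝔼 n` is the model Euclidean space `EuclideanSpace ℝ (Fin n)`. -/
local notation "𝔼 " n:arg => EuclideanSpace ℝ (Fin n)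

namespace ProjBundle

variable {n m k : ℕ} {M : Type*} [TopologicalSpace M] [ChartedSpace (𝔼 n) M]
  {P : ProjBundle n m k M} {o₁ o₂ : ∀ x, Orientation ℝ (P.fibre x) (Fin k)}

/-- **The agreement set of two orientations is open.** [cite: MilnorStasheff1974, §9 p. 96] -/
theorem IsOrientation.isOpen_setOf_eq (h₁ : P.IsOrientation o₁) (h₂ : P.IsOrientation o₂) :
    IsOpen {x | o₁ x = o₂ x} := by
  rw [isOpen_iff_mem_nhds]
  intro x₀ hx₀
  have h0 : o₁ x₀ = o₂ x₀ := hx₀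
  filter_upwards [h₁.eventually_iff x₀, h₂.eventually_iff x₀,
    (P.isOpen_goodSet x₀).mem_nhds (P.mem_goodSet_self x₀)] with x e₁ e₂ hxg
  have i₁ := e₁ hxg
  have i₂ := e₂ hxg
  rw [h0] at i₁
  -- `o₁ x = C ↔ o₂ x = C` for the chart orientation `C`
  have key : o₁ x = P.chartOrientation hxg ↔ o₂ x = P.chartOrientation hxg := i₁.trans i₂.symm
  show o₁ x = o₂ x
  by_cases hc : o₁ x = P.chartOrientation hxg
  · rw [hc, ← key.1 hc]
  · have hc₂ : o₂ x ≠ P.chartOrientation hxg := fun h => hc (key.2 h)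
    -- both are the opposite of the chart orientation
    have e1 : -o₁ x = P.chartOrientation hxg := (P.neg_eq_iff_ne _ _).2 hc
    have e2 : -o₂ x = P.chartOrientation hxg := (P.neg_eq_iff_ne _ _).2 hc₂
    exact neg_inj.1 (e1.trans e2.symm)

/-- **Two orientations over a preconnected base agree or are opposite.**
[cite: MilnorStasheff1974, §9 p. 96] -/
theorem IsOrientation.eq_or_eq_neg [PreconnectedSpace M] (h₁ : P.IsOrientation o₁)
    (h₂ : P.IsOrientation o₂) : o₁ = o₂ ∨ o₁ = fun x => -o₂ x := by
  have hopen : IsOpen {x | o₁ x = o₂ x} := h₁.isOpen_setOf_eq h₂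
  have hopen' : IsOpen {x | o₁ x = -o₂ x} := h₁.isOpen_setOf_eq h₂.neg
  have hcompl : {x | o₁ x = o₂ x}ᶜ = {x | o₁ x = -o₂ x} := by
    ext x
    simp only [mem_compl_iff, mem_setOf_eq]
    rw [eq_comm (b := -o₂ x), P.neg_eq_iff_ne, ne_comm]
  have hclosed : IsClosed {x | o₁ x = o₂ x} := by
    rw [← isOpen_compl_iff, hcompl]
    exact hopen'
  rcases isClopen_iff.1 ⟨hclosed, hopen⟩ with h | h
  · right
    funext x
    have hx : x ∈ ({x | o₁ x = o₂ x} : Set M)ᶜ := by rw [h]; exact fun h' => h'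
    rw [hcompl] at hx
    exact hx
  · left
    funext x
    have hx : x ∈ ({x | o₁ x = o₂ x} : Set M) := by rw [h]; trivial
    exact hx

end ProjBundle

end Literature.Topology.Immersions
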